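import Literature.AlgebraicGeometry.CossartJannsenSaito2020.ProjDirProjectiveSpace
import Literature.AlgebraicGeometry.CossartJannsenSaito2020.ProjDirProjectiveLineRegular
import Literature.AlgebraicGeometry.CossartJannsenSaito2020.ProjDirProjectiveLineResidue
import Literature.RingTheory.HilbertSamuel.ProjDirectrixSpace
import Literature.RingTheory.HilbertSamuel.ProjDirectrixSpaceChart
import Literature.AlgebraicGeometry.Resolution.AffineDomainEquidim
import Mathlib.RingTheory.RegularLocalRing.Polynomial
import Mathlib.RingTheory.KrullDimension.Field
import HarnessLib

/-!
# CJS LNM 2270, p. 103 L16 / Def. 6.34 (i) for EVERY `t = e_x(X) ≥ 1`: `C_1 = ℙ(Dir_x(X)) ⊂ Bℓ_x(X)` is a closed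
# irreducible set whose reduced local rings are regular — PROOF, and the DISCHARGE `ProjDir_projSpace_holds`

Source: V. Cossart, U. Jannsen, S. Saito, *Desingularization: Invariants and Strategy*, LNM **2270** (2020)
[`CossartJannsenSaito2020`], p. 103 L16 «We note `C_1 ≃ ℙ^{t−1}_k`, where `t = e^O_x(X)`», Def. 6.34 (i) (p. 104)
«`C_1 = ℙ(Dir^O_x(X)) ≅ ℙ^{t−1}_{k(x)}` (`t = e^O_x(X)`)»; typed (statement only, p529373) as
`Literature.AlgebraicGeometry.CossartJannsenSaito2020.ProjDir_projSpace`. This file PROVES it (`ProjDir_projSpace_holds`), the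
general-`t` form of `ProjDirProjectiveLineCharts.lean` + `ProjDirProjectiveLineRegular.lean` (`t = 2`), with `t` charts in
place of two:

1. (`ProjDirectrixSpace.lean`) among generators `c_1, …, c_r` of `𝔭_x` over an affine open `U ∋ x` there are `c_{j_0}, …,
   c_{j_q}`, `t = q + 1`, whose symbols form a basis of `S_1/𝒯`; at a point `ξ ∈ ℙ(Dir_x(X))` the exceptional ideal is
   `(c_{j_0}, …, c_{j_q})𝒪_ξ` (`map_maximalIdeal_eq_span_family_of_projDirLiftsInto`), hence — being invertible — generated by
   ONE `c_{j_i}`: `ℙ(Dir)` is covered by the `t` blow-up charts `g_i : Spec D_i → X'` at the adapted generators;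
2. (`ProjDirectrixSpaceChart.lean`) on the chart at `c_{j_i}`, `ℙ(Dir) ∩ Spec D_i = V(𝔑_i)` (`mem_projDirectrixFibre_chart_iff`)
   with `D_i/𝔑_i ≅ k(x)[T_1, …, T_q]`; so `𝔑_i` is prime, the other adapted ratios `c_{j_{i'}}/c_{j_i}` are NOT in `𝔑_i`, and
   therefore the point `g_i(𝔑_i)` lies on every other chart: all these points specialise to one another and to every point of
   `ℙ(Dir)`, so `g_0(𝔑_0)` is a generic point of the closed set `ℙ(Dir)` (`isClosed_projDirectrixFibre`), which is irreducible;
3. the local ring `𝒪_{X',y}/𝓘_{C_1,y}` at `y = g_i(w)` is `(D_i)_w/𝔑_i (D_i)_w` (`nonempty_quotient_primeOfSpecializes_ringEquiv`,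
   `stalkIdeal_vanishingIdeal_closure`), a localisation of `k(x)[T_1, …, T_q]` at a prime: regular (Mathlib: polynomial rings
   over a field are regular rings), of dimension `0` at `𝔑_i` itself and of dimension `q = t − 1` at a maximal ideal
   (`MvPolynomial.height_eq_of_isMaximal`) — and `w` is maximal when `y` is a closed point of `X'`; at such `y` the
   residue extension `k(x) → k(y)` is finite because blow-ups are proper (`finite_residueFieldMap_of_isClosed`).

Boundary-free. NOT a statement of H. Hironaka's manuscript; a PROOF of a typed published statement of [CJS 2020] for the
L-lane of cell res-hironaka ([L W4.2] support, res-L1-w42-plan-1 RULING v3.14-16 (EN)). AI-written (res-type-031); weaker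
than expert review. `ProjDir_projSpace_genericResidueField` is NOT proved here.

## References

* V. Cossart, U. Jannsen, S. Saito, LNM 2270 (2020), Def. 2.18, Def. 6.34 (i), Lemma 6.33, p. 103, p. 104.
  [CossartJannsenSaito2020]
* The Stacks Project, Tag 0804 (charts of a blowing up), Tag 01J7 (points of `Spec 𝒪_{X,x}`), Tag 01TB. [StacksProject]
-/

noncomputable section

open CategoryTheory AlgebraicGeometry TopologicalSpace IsLocalRing
open Literature.AlgebraicGeometry.Resolution Literature.RingTheory.HilbertSamuel Literature.RingTheory.MvPolynomial

namespace Literature.AlgebraicGeometry.CossartJannsenSaito2020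

universe u

/-! ## Plumbing (private copies of the chart lemmas of `ProjDirClosed.lean`) -/

/-- The chart `g_j : Spec (R[It])_{(c_j t)} → X'` of a blowing up along `C` over an affine open `U` at a member `c_j` of a
generating family `c` of `C(U)`: an open immersion over `Spec R → X` through `chartBase c j`, containing every point at
which `c_j` generates the exceptional ideal. [cite: StacksProject, Tag 0804] -/
private theorem exists_chart_of_ideal_eq_span₆ {X' X : Scheme.{u}} {π : X' ⟶ X} {C : X.IdealSheafData}
    (hπ : IsBlowup π C) (U : X.affineOpens) {r : ℕ} (c : Fin r → Γ(X, U))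
    (hc : C.ideal U = Ideal.span (Set.range c)) (j : Fin r) :
    ∃ g : Spec (.of (chartRing c j)) ⟶ X', IsOpenImmersion g ∧
      g ≫ π = Spec.map (CommRingCat.ofHom (chartBase c j)) ≫ U.2.fromSpec ∧
      ∀ (x' : X') (hx : π x' ∈ (U : X.Opens)),
        stalkIdeal (C.comap π) x' =
            Ideal.span {(π.stalkMap x').hom ((X.presheaf.germ U (π x') hx).hom (c j))} →
          x' ∈ Set.range g := by
  have key : ∀ (I : Ideal Γ(X, U)) (_ : C.ideal U = I) (b : Γ(X, U)) (hb : b ∈ I),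
      ∃ g : Spec (.of (HomogeneousLocalization.Away (reesGrading I) (reesT b hb))) ⟶ X',
        IsOpenImmersion g ∧
        g ≫ π = Spec.map (CommRingCat.ofHom (reesChartBase b hb)) ≫ U.2.fromSpec ∧
        ∀ (x' : X') (hx : π x' ∈ (U : X.Opens)),
          stalkIdeal (C.comap π) x' =
              Ideal.span {(π.stalkMap x').hom ((X.presheaf.germ U (π x') hx).hom b)} →
            x' ∈ Set.range g := by
    rintro I rfl b hb
    obtain ⟨g, h1, h2, -⟩ := hπ.exists_charts U
    exact ⟨g b hb, h1 b hb, h2 b hb, fun x' hx hgen =>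
      hπ.mem_range_chart_of_stalkIdeal_eq_span U hb (g b hb) (h2 b hb) hx hgen⟩
  exact key _ hc (c j) (Ideal.mem_span_range_self (f := c) (x := j))

/-- **In a local ring, if `(u_1, …, u_r) = (t)` with `t` a nonzerodivisor, then `(u_j) = (t)` for some `j`.** Writing
`u_l = t b_l` and `t = Σ a_l u_l = t Σ a_l b_l` gives `Σ a_l b_l = 1`, so some `b_j` is a unit. [folklore] -/
private theorem exists_span_singleton_eq_of_span_range_eq₆ {B : Type u} [CommRing B] [IsLocalRing B] {r : ℕ}
    (u : Fin r → B) {t : B} (ht : t ∈ nonZeroDivisors B) (h : Ideal.span (Set.range u) = Ideal.span {t}) :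
    ∃ j, Ideal.span {u j} = Ideal.span {t} := by
  classical
  have hb : ∀ l, ∃ b : B, b * t = u l := fun l =>
    Ideal.mem_span_singleton'.mp (h ▸ Ideal.subset_span ⟨l, rfl⟩)
  choose b hb using hb
  obtain ⟨a, ha⟩ : ∃ a : Fin r → B, ∑ l, a l * u l = t :=
    Ideal.mem_span_range_iff_exists_fun.mp (h.symm ▸ Ideal.mem_span_singleton_self t)
  have hsum : ∑ l, a l * b l = 1 := by
    have h1 : (∑ l, a l * b l - 1) * t = 0 := by
      rw [sub_mul, one_mul, Finset.sum_mul, sub_eq_zero]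
      conv_rhs => rw [← ha]
      exact Finset.sum_congr rfl fun l _ => by rw [mul_assoc, hb l]
    exact sub_eq_zero.mp ((mem_nonZeroDivisors_iff_right.mp ht) _ h1)
  have hex : ∃ j, IsUnit (a j * b j) := by
    by_contra hall
    simp only [not_exists] at hall
    have hmem : ∑ l, a l * b l ∈ maximalIdeal B :=
      Ideal.sum_mem _ fun l _ => (mem_maximalIdeal _).mpr (mem_nonunits_iff.mpr (hall l))
    rw [hsum] at hmem
    exact (mem_maximalIdeal _).mp hmem isUnit_one
  obtain ⟨j, hj⟩ := hex
  refine ⟨j, ?_⟩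
  have hbj : IsUnit (b j) := isUnit_of_mul_isUnit_right hj
  rw [← hb j, Ideal.span_singleton_mul_left_unit hbj]

/-! ## Ring-level facts: an ideal with quotient a polynomial ring in `q` variables over a field -/
section Quotient

variable {D : Type u} [CommRing D] {k : Type u} [Field k] {q : ℕ} (N : Ideal D)
  (Ξ : MvPolynomial (Fin q) k ≃+* D ⧸ N)

include Ξ in
/-- An ideal with quotient `≅ k[T_1, …, T_q]` is prime. [folklore] -/
private theorem isPrime_of_ringEquiv_mvPolynomial : N.IsPrime := by
  haveI : IsDomain (D ⧸ N) := MulEquiv.isDomain (MvPolynomial (Fin q) k) Ξ.symm.toMulEquiv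
  exact (Ideal.Quotient.isDomain_iff_prime N).mp inferInstance

include Ξ in
/-- If `Ξ(T_m) = d̄` then `d ∉ N` (`T_m ≠ 0`). [folklore] -/
private theorem not_mem_of_ringEquiv_mvPolynomial_X {m : Fin q} {d : D}
    (hΞ : Ξ (MvPolynomial.X m) = Ideal.Quotient.mk N d) : d ∉ N := by
  intro hd
  have h1 : Ξ (MvPolynomial.X m) = 0 := by rw [hΞ, Ideal.Quotient.eq_zero_iff_mem.mpr hd]
  exact MvPolynomial.X_ne_zero m (Ξ.injective (h1.trans (map_zero Ξ).symm))

/-- **Localising the ring `D/N ≅ k[T_1, …, T_q]` of `ℙ(Dir)`**: for a prime `w ⊇ N` and a localisation `L` of `D` at `w`, the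
ring `L/N L` is a localisation of `k[T_1, …, T_q]` at a prime, hence a regular local ring (polynomial rings over a field are
regular rings) — of dimension `0` (the function field) if `w = N`, and of dimension `q` if `w` is maximal (maximal ideals of
`k[T_1, …, T_q]` have height `q`). The `q = 1` case is in `ProjDirProjectiveLineRegular.lean`.
[cite: Matsumura1987, §5 Ex. 5.1] -/
private theorem regular_quotient_of_ringEquiv_mvPolynomial (Ξ : MvPolynomial (Fin q) k ≃+* D ⧸ N)
    (w : Ideal D) [w.IsPrime] (hNw : N ≤ w)
    (L : Type u) [CommRing L] [Algebra D L] [IsLocalization.AtPrime L w] :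
    IsRegularLocalRing (L ⧸ N.map (algebraMap D L)) ∧
      (w = N → ringKrullDim (L ⧸ N.map (algebraMap D L)) = 0) ∧
      (w.IsMaximal → ringKrullDim (L ⧸ N.map (algebraMap D L)) = (q : ℕ)) := by
  classical
  set Q := L ⧸ N.map (algebraMap D L) with hQ
  -- `w̄ ⊆ D/N`
  set wb : Ideal (D ⧸ N) := w.map (Ideal.Quotient.mk N) with hwb
  have hker : RingHom.ker (Ideal.Quotient.mk N) ≤ w := by rw [Ideal.mk_ker]; exact hNw
  haveI hwbp : wb.IsPrime := Ideal.map_isPrime_of_surjective Ideal.Quotient.mk_surjective hker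
  have hcomap : wb.comap (Ideal.Quotient.mk N) = w := by
    rw [hwb, Ideal.comap_map_of_surjective _ Ideal.Quotient.mk_surjective, sup_eq_left]
    intro d hd
    exact hker hd
  -- `Q` is the localisation of `D/N` at `w̄`
  have hsub : Algebra.algebraMapSubmonoid (D ⧸ N) w.primeCompl = wb.primeCompl := by
    ext q'
    constructor
    · rintro ⟨s, hs, rfl⟩
      intro hq
      apply hs
      change s ∈ w
      rw [← hcomap, Ideal.mem_comap]
      exact hq
    · intro hq
      obtain ⟨s, rfl⟩ := Ideal.Quotient.mk_surjective q'
      refine ⟨s, fun hs => hq ?_, rfl⟩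
      exact Ideal.mem_map_of_mem _ hs
  haveI hQloc : IsLocalization.AtPrime Q wb := by
    have h : IsLocalization (Algebra.algebraMapSubmonoid (D ⧸ N) w.primeCompl) Q := inferInstance
    rwa [hsub] at h
  haveI : IsLocalRing Q := IsLocalization.AtPrime.isLocalRing Q wb
  -- transport to `k[T]`
  set 𝔮 : Ideal (MvPolynomial (Fin q) k) := wb.comap Ξ.toRingHom with h𝔮
  haveI : 𝔮.IsPrime := Ideal.IsPrime.comap _
  set K := Localization.AtPrime 𝔮 with hK
  have e : K ≃+* Q :=
    IsLocalization.ringEquivOfRingEquiv (M := 𝔮.primeCompl) (T := wb.primeCompl) K Q Ξ (by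
      ext y; constructor
      · rintro ⟨x, hx, rfl⟩
        exact fun h => hx (by simpa [h𝔮, Ideal.mem_comap] using h)
      · intro hy
        refine ⟨Ξ.symm y, fun h => hy ?_, by simp⟩
        simpa [h𝔮, Ideal.mem_comap] using h)
  -- `K` is regular: `k[T_1, …, T_q]` is a regular ring
  haveI : IsRegularRing (MvPolynomial (Fin q) k) := inferInstance
  have hregK : IsRegularLocalRing K := IsRegularRing.isRegularLocalRing_localization 𝔮
  haveI := hregK
  refine ⟨IsRegularLocalRing.of_ringEquiv e, fun hw => ?_, fun hwmax => ?_⟩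
  · -- `w = N`: `𝔮 = ⊥`, `K` is the field `k(T)`
    subst hw
    have hwb0 : wb = ⊥ := by rw [hwb, Ideal.map_eq_bot_iff_le_ker, Ideal.mk_ker]
    have h𝔮0 : 𝔮 = ⊥ := by
      rw [h𝔮, eq_bot_iff]
      intro p hp
      rw [Ideal.mem_comap, hwb0, Ideal.mem_bot] at hp
      rw [Ideal.mem_bot]
      exact Ξ.injective (hp.trans (map_zero Ξ).symm)
    have hmK : maximalIdeal K = ⊥ := by
      rw [← IsLocalization.AtPrime.map_eq_maximalIdeal 𝔮 K, Ideal.map_eq_bot_iff_le_ker]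
      intro p hp
      rw [h𝔮0, Ideal.mem_bot] at hp
      rw [RingHom.mem_ker, hp, map_zero]
    have hFK : IsField K := (IsLocalRing.isField_iff_maximalIdeal_eq).mpr hmK
    rw [← ringKrullDim_eq_of_ringEquiv e]
    exact ringKrullDim_eq_zero_of_isField hFK
  · -- `w` maximal: `𝔮` is a maximal ideal of `k[T_1, …, T_q]`, of height `q`
    haveI := hwmax
    have hwbmax : wb.IsMaximal := by
      rcases Ideal.map_eq_top_or_isMaximal_of_surjective (Ideal.Quotient.mk N) Ideal.Quotient.mk_surjective hwmax
        with htop | hmax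
      · exact absurd htop hwbp.ne_top
      · exact hmax
    haveI h𝔮max : 𝔮.IsMaximal := by
      rw [h𝔮]
      exact Ideal.comap_isMaximal_of_surjective _ Ξ.surjective
    rw [← ringKrullDim_eq_of_ringEquiv e, IsLocalization.AtPrime.ringKrullDim_eq_height 𝔮 K,
      MvPolynomial.height_eq_of_isMaximal k q 𝔮]
    rfl

end Quotient

/-! ## One chart: the local rings of `ℙ(Dir)` at the points of a chart piece `≅ Spec k[T_1, …, T_q]` -/

section ChartLocal

variable {X' : Scheme.{u}} {D : CommRingCat.{u}} (g : Spec D ⟶ X') [IsOpenImmersion g] {k : Type u} [Field k] {q : ℕ}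
  (S : Set X') (hC : IsClosed S) (N : Ideal D) (Ξ : MvPolynomial (Fin q) k ≃+* D ⧸ N)
  (hkey : ∀ w : Spec D, g w ∈ S ↔ N ≤ w.asIdeal) (hN : N.IsPrime)
  (hGP : IsGenericPoint (g ⟨N, hN⟩) S)

include Ξ hkey hGP in
/-- **On a chart `g : Spec D → X'` on which the closed set `S` is `V(N)` with `D/N ≅ k[T_1, …, T_q]` and whose point `N` is
generic in `S`, the local rings `𝒪_{X',y}/𝓘_{S,y}` at the points `y = g(w)` of `S` are regular, of dimension `0` at the
generic point and of dimension `q` at the points closed in `X'`** (`𝓘_{S,y} = 𝔭_{g(N)}`, `stalkIdeal_vanishingIdeal_closure`;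
then `nonempty_quotient_primeOfSpecializes_ringEquiv` and the localisations of `k[T_1, …, T_q]`).
[cite: CossartJannsenSaito2020, Def. 6.34 (i), p. 103 L16] -/
theorem isRegularLocalRing_quotient_stalkIdeal_of_chart_mv (w : Spec D) (hy : g w ∈ S) :
    IsRegularLocalRing (X'.presheaf.stalk (g w) ⧸ stalkIdeal (Scheme.IdealSheafData.vanishingIdeal ⟨S, hC⟩) (g w)) ∧
      (IsGenericPoint (g w) S →
        ringKrullDim (X'.presheaf.stalk (g w) ⧸
          stalkIdeal (Scheme.IdealSheafData.vanishingIdeal ⟨S, hC⟩) (g w)) = 0) ∧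
      (IsClosed ({g w} : Set X') →
        ringKrullDim (X'.presheaf.stalk (g w) ⧸
          stalkIdeal (Scheme.IdealSheafData.vanishingIdeal ⟨S, hC⟩) (g w)) = (q : ℕ)) := by
  classical
  set ηpt : Spec D := ⟨N, hN⟩ with hηpt
  have hNw : N ≤ w.asIdeal := (hkey w).mp hy
  have h' : ηpt ⤳ w :=
    (PrimeSpectrum.le_iff_specializes ηpt w).mp ((PrimeSpectrum.asIdeal_le_asIdeal ηpt w).mp hNw)
  have h : g ηpt ⤳ g w := h'.map g.continuous
  have hCl : (⟨S, hC⟩ : Closeds X') = ⟨closure {g ηpt}, isClosed_closure⟩ := Closeds.ext hGP.symm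
  have hstalk : stalkIdeal (Scheme.IdealSheafData.vanishingIdeal ⟨S, hC⟩) (g w) = primeOfSpecializes h := by
    rw [hCl]
    exact stalkIdeal_vanishingIdeal_closure h
  -- `g w` generic iff `w = N`
  have hgen_iff : IsGenericPoint (g w) S ↔ w.asIdeal = N := by
    constructor
    · intro hg
      have heq : g w = g ηpt := hg.eq hGP
      have : w = ηpt := g.isOpenEmbedding.injective heq
      rw [this]
    · intro heq
      have : w = ηpt := PrimeSpectrum.ext heq
      rw [this]
      exact hGP
  -- `g w` closed ⇒ `w` maximal
  have hmax_of_closed : IsClosed ({g w} : Set X') → w.asIdeal.IsMaximal := by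
    intro hcl
    have hpre : IsClosed ({w} : Set (Spec D)) := by
      have h1 : g ⁻¹' {g w} = {w} := by
        ext w'
        simp only [Set.mem_preimage, Set.mem_singleton_iff]
        exact ⟨fun h => g.isOpenEmbedding.injective h, fun h => by rw [h]⟩
      rw [← h1]
      exact hcl.preimage g.continuous
    exact (PrimeSpectrum.isClosed_singleton_iff_isMaximal w).mp hpre
  -- transport to `𝒪_{Spec D, w} / N`
  letI : Algebra D ((Spec D).presheaf.stalk w) :=
    ((Scheme.ΓSpecIso D).inv ≫ (Spec D).presheaf.germ ⊤ w trivial).hom.toAlgebra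
  haveI hlocL : IsLocalization.AtPrime ((Spec D).presheaf.stalk w) w.asIdeal :=
    StructureSheaf.IsLocalization.to_stalk (R := D) w
  obtain ⟨e⟩ := nonempty_quotient_primeOfSpecializes_ringEquiv g ηpt w h' h
  obtain ⟨hreg, hdim0, hdimq⟩ :=
    regular_quotient_of_ringEquiv_mvPolynomial N Ξ w.asIdeal hNw ((Spec D).presheaf.stalk w)
  rw [hstalk]
  haveI := hreg
  refine ⟨IsRegularLocalRing.of_ringEquiv e.symm, fun hg => ?_, fun hcl => ?_⟩
  · rw [ringKrullDim_eq_of_ringEquiv e]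
    exact hdim0 (hgen_iff.mp hg)
  · rw [ringKrullDim_eq_of_ringEquiv e]
    exact hdimq (hmax_of_closed hcl)

end ChartLocal

/-! ## The theorem -/

set_option maxHeartbeats 1600000 in
-- one long proof over large chart types (`t` Rees charts `chartRing c j` over `Γ(X, U)`), as in `ProjDirLine.lean`
/-- **CJS 2020, p. 103 L16 / Def. 6.34 (i) for every `t = e_x(X) = q + 1 ≥ 1`, PROVED: `C_1 = ℙ(Dir_x(X)) ⊂ Bℓ_x(X)` is
closed and irreducible, and the local rings of its reduced closed subscheme structure are regular, of dimension `0` at the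
generic point and of dimension `t − 1` with finite residue extension `k(x) → k(y)` at the points closed in `X'`** — for a
blow-up `π : X' ⟶ X` of a locally noetherian `X` in a closed point `x` with `e_x(X) = q + 1` (module docstring for the proof:
`q + 1` charts `≅ Spec k(x)[T_1, …, T_q]` at generators adapted to the directrix). All clauses of the named fact
`ProjDir_projSpace`. [cite: CossartJannsenSaito2020, Def. 6.34 (i), p. 103 L16] -/
theorem projDirectrixFibre_projSpace {X X' : Scheme.{u}} [IsLocallyNoetherian X] (π : X' ⟶ X) (x : X)
    (hx : IsClosed ({x} : Set X)) (hπ : IsBlowup π (Scheme.IdealSheafData.vanishingIdeal ⟨{x}, hx⟩)) {q : ℕ}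
    (hdir : Scheme.dirDim X x = q + 1) :
    IsClosed (projDirectrixFibre π x) ∧ IsIrreducible (projDirectrixFibre π x) ∧
    ∀ (hC : IsClosed (projDirectrixFibre π x)) (y : X'), y ∈ projDirectrixFibre π x →
      IsRegularLocalRing (X'.presheaf.stalk y ⧸
        stalkIdeal (Scheme.IdealSheafData.vanishingIdeal ⟨projDirectrixFibre π x, hC⟩) y) ∧
      (IsGenericPoint y (projDirectrixFibre π x) →
        ringKrullDim (X'.presheaf.stalk y ⧸
          stalkIdeal (Scheme.IdealSheafData.vanishingIdeal ⟨projDirectrixFibre π x, hC⟩) y) = 0) ∧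
      (IsClosed ({y} : Set X') →
        ringKrullDim (X'.presheaf.stalk y ⧸
          stalkIdeal (Scheme.IdealSheafData.vanishingIdeal ⟨projDirectrixFibre π x, hC⟩) y) = (q : ℕ) ∧
        (π.residueFieldMap y).hom.Finite) := by
  classical
  have hSclosed : IsClosed (projDirectrixFibre π x) := isClosed_projDirectrixFibre π x hx hπ
  set S := projDirectrixFibre π x with hS
  -- (0) the centre, an affine open `U ∋ x`, `𝔭 = 𝔭_x ⊆ R = Γ(X, U)`, `𝒪_{X,x} = R_𝔭`
  obtain ⟨U, hxU⟩ : ∃ U : X.affineOpens, x ∈ (U : X.Opens) := by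
    obtain ⟨U₀, hU, hxU, -⟩ :=
      exists_isAffineOpen_mem_and_subset (X := X) (x := x) (U := ⊤) (Opens.mem_top x)
    exact ⟨⟨U₀, hU⟩, hxU⟩
  set A := X.presheaf.stalk x with hA
  obtain ⟨𝔭, h𝔭⟩ : ∃ 𝔭 : PrimeSpectrum Γ(X, U), 𝔭 = U.2.primeIdealOf ⟨x, hxU⟩ := ⟨_, rfl⟩
  haveI h𝔭max : 𝔭.asIdeal.IsMaximal := h𝔭 ▸ U.2.primeIdealOf_isMaximal_of_isClosed ⟨x, hxU⟩ hx
  haveI : IsNoetherianRing Γ(X, U) := IsLocallyNoetherian.component_noetherian U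
  letI : Algebra Γ(X, U) A := TopCat.Presheaf.algebra_section_stalk X.presheaf (⟨x, hxU⟩ : (U : X.Opens))
  haveI hloc : IsLocalization.AtPrime A 𝔭.asIdeal := h𝔭 ▸ U.2.isLocalization_stalk ⟨x, hxU⟩
  have halg : ∀ s : Γ(X, U), algebraMap Γ(X, U) A s = (X.presheaf.germ U x hxU).hom s := fun _ => rfl
  have hI : (Scheme.IdealSheafData.vanishingIdeal (⟨{x}, hx⟩ : Closeds X)).ideal U = 𝔭.asIdeal := by
    rw [h𝔭]
    exact vanishingIdeal_singleton_ideal U.2 hx hxU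
  obtain ⟨r, c, hc⟩ : ∃ (r : ℕ) (c : Fin r → Γ(X, U)), Ideal.span (Set.range c) = 𝔭.asIdeal :=
    Submodule.fg_iff_exists_fin_generating_family.mp (IsNoetherian.noetherian 𝔭.asIdeal)
  have hIc : (Scheme.IdealSheafData.vanishingIdeal (⟨{x}, hx⟩ : Closeds X)).ideal U = Ideal.span (Set.range c) :=
    hI.trans hc.symm
  have hcm : ∀ l, algebraMap Γ(X, U) A (c l) ∈ maximalIdeal A :=
    fun l => (IsLocalization.AtPrime.to_map_mem_maximal_iff A 𝔭.asIdeal (c l)).mpr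
      (hc ▸ Ideal.subset_span ⟨l, rfl⟩)
  have hspanA : Ideal.span (Set.range fun l => algebraMap Γ(X, U) A (c l)) = maximalIdeal A := by
    have h := IsLocalization.AtPrime.map_eq_maximalIdeal 𝔭.asIdeal A
    rwa [← hc, Ideal.map_span, ← Set.range_comp] at h
  have hexp : ∀ l, ∃ a : Fin (maximalIdeal A).spanFinrank → A,
      ∑ i, a i * minGenerators A i = algebraMap Γ(X, U) A (c l) :=
    fun l => Ideal.mem_span_range_iff_exists_fun.mp (by rw [span_range_minGenerators]; exact hcm l)
  choose a ha using hexp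
  have ha' : ∀ l, algebraMap Γ(X, U) A (c l) = ∑ i, a l i * minGenerators A i := fun l => (ha l).symm
  have hd : directrixDim (tangentConeIdeal (minGenerators A) (span_range_minGenerators A)) = q + 1 := hdir
  -- (1) the charts at the generators, and the chart description of `S`
  have hcharts := fun j => exists_chart_of_ideal_eq_span₆ hπ U c hIc j
  choose g hgopen hgπ hgmem using hcharts
  have hkey : ∀ (j : Fin r) (w : Spec (.of (chartRing c j))),
      g j w ∈ S ↔
        ((U.2.primeIdealOf ⟨x, hxU⟩).asIdeal.map (CommRingCat.ofHom (chartBase c j)).hom ⊔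
          Ideal.span {d : chartRing c j | ∃ lam : Fin r → Γ(X, U),
            (linForm fun i => ∑ l, residue (X.presheaf.stalk x) ((X.presheaf.germ U x hxU).hom (lam l)) *
                residue (X.presheaf.stalk x) (a l i)) ∈
              directrixSpace (canonicalTangentConeIdeal (X.presheaf.stalk x)) ∧
            d = ∑ l, (CommRingCat.ofHom (chartBase c j)).hom (lam l) * chartGen c j l}) ≤ w.asIdeal := by
    intro j w
    haveI := hgopen j
    exact mem_projDirectrixFibre_chart_iff π U hxU (CommRingCat.ofHom (chartBase c j)) c j
      (fun l => chartGen c j l) a (g j) (hgπ j) (fun k => reesChartBase_apply_eq_mul_chartGen c j k)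
      (reesChartBase_mem_nonZeroDivisors (c j) (Ideal.mem_span_range_self (f := c) (x := j))) hx
      (h𝔭 ▸ hc) ha w
  -- (2) an adapted family of generators `c_{j_0}, …, c_{j_q}`
  obtain ⟨j, hjs, hji⟩ := exists_family_symbols_basis_mod_directrixSpace (span_range_minGenerators A) rfl hspanA a ha' hd
  -- (3) per-chart structure at each adapted generator, with the isomorphism `Ξ`
  letI instF : Field (Γ(X, U) ⧸ 𝔭.asIdeal) := Ideal.Quotient.field 𝔭.asIdeal
  have hchart : ∀ i₀ : Fin (q + 1),
      ∃ (N : Ideal (chartRing c (j i₀)))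
        (_ : MvPolynomial (Fin q) (Γ(X, U) ⧸ 𝔭.asIdeal) ≃+* chartRing c (j i₀) ⧸ N),
        (∀ w : Spec (.of (chartRing c (j i₀))), g (j i₀) w ∈ S ↔ N ≤ w.asIdeal) ∧
        N.IsPrime ∧ ∀ m : Fin q, chartGen c (j i₀) (j (i₀.succAbove m)) ∉ N := by
    intro i₀
    obtain ⟨hsp, hind⟩ := basis_mod_directrixSpace_succAbove (span_range_minGenerators A) a hjs hji i₀
    obtain ⟨Ξ, -, hΞX⟩ := exists_ringEquiv_mvPolynomial_quotient_chartIdeal 𝔭.asIdeal A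
      (span_range_minGenerators A) a ha (chartBase c (j i₀)) (fun l => chartGen c (j i₀) l) (j i₀)
      (fun m => j (i₀.succAbove m)) (chartGen_self c (j i₀))
      (fun d => exists_isHomogeneous_eval₂_eq c (j i₀) d)
      (fun m F hF => reesChartBase_eval_eq_pow_mul_eval₂ c (j i₀) hF)
      (fun z hz => exists_pow_mul_eq_zero_of_reesChartBase_eq_zero c (j i₀) hz) hsp hind
    refine ⟨_, Ξ, fun w => ?_, isPrime_of_ringEquiv_mvPolynomial _ Ξ, fun m => ?_⟩
    · rw [hkey (j i₀) w, h𝔭]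
      exact Iff.rfl
    · exact not_mem_of_ringEquiv_mvPolynomial_X _ Ξ (hΞX m)
  choose N Ξ hkeyN hprimeN hgenN using hchart
  set ηpt : ∀ i : Fin (q + 1), Spec (.of (chartRing c (j i))) := fun i => ⟨N i, hprimeN i⟩ with hηpt
  have hηS : ∀ i, g (j i) (ηpt i) ∈ S := fun i => (hkeyN i (ηpt i)).mpr le_rfl
  -- (4) every point of `S` lies on one of the `q + 1` charts
  have hcover : ∀ ξ ∈ S, ∃ i, ξ ∈ Set.range (g (j i)) := by
    intro ξ hξ
    obtain ⟨hξx, hP⟩ := (mem_projDirectrixFibre π x ξ).mp hξ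
    have hξU : π.base ξ ∈ (U : X.Opens) := hξx ▸ hxU
    let ι : A ≅ X.presheaf.stalk (π.base ξ) := X.presheaf.stalkCongr (.of_eq hξx.symm)
    haveI : IsLocalHom (π.stalkMap ξ).hom := π.toLRSHom.prop ξ
    let φ : A →+* X'.presheaf.stalk ξ := (π.stalkMap ξ).hom.comp ι.hom.hom
    have hφgerm : ∀ s : Γ(X, U), φ (algebraMap Γ(X, U) A s) =
        (π.stalkMap ξ).hom ((X.presheaf.germ U (π.base ξ) hξU).hom s) := by
      intro s
      rw [halg, RingHom.comp_apply]
      change (π.stalkMap ξ).hom ((X.presheaf.germ U x hxU ≫ ι.hom).hom s) = _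
      rw [TopCat.Presheaf.stalkCongr_hom, TopCat.Presheaf.germ_stalkSpecializes]
    have hφm : (maximalIdeal A).map φ ≤ maximalIdeal (X'.presheaf.stalk ξ) := by
      rw [Ideal.map_le_iff_le_comap]
      intro m hm
      rw [Ideal.mem_comap, RingHom.comp_apply]
      refine map_nonunit (π.stalkMap ξ).hom _ ?_
      rw [mem_maximalIdeal, mem_nonunits_iff] at hm ⊢
      have h2 : ι.inv.hom (ι.hom.hom m) = m := by
        change (ι.hom ≫ ι.inv).hom m = m
        rw [Iso.hom_inv_id]
        rfl
      exact fun hu => hm (h2 ▸ hu.map ι.inv.hom)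
    have hPφ : ProjDirLiftsInto φ (minGenerators A) (span_range_minGenerators A) :=
      (isOnProjDirectrix_iff_projDirLiftsInto π hξx).mp hP
    have hfam := map_maximalIdeal_eq_span_family_of_projDirLiftsInto (span_range_minGenerators A) a ha' hjs φ hφm hPφ
    obtain ⟨t, ht, hKt⟩ := hπ.isEffectiveCartier.exists_stalkIdeal_eq_span ξ
    have hK : stalkIdeal ((Scheme.IdealSheafData.vanishingIdeal (⟨{x}, hx⟩ : Closeds X)).comap π) ξ =
        Ideal.span (Set.range fun i => (π.stalkMap ξ).hom ((X.presheaf.germ U (π.base ξ) hξU).hom (c (j i)))) := by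
      rw [stalkIdeal_comap_eq_map, stalkIdeal_eq_map_germ _ U hξU, hIc, Ideal.map_map, Ideal.map_span,
        ← Set.range_comp]
      have h1 : Ideal.span (Set.range (((π.stalkMap ξ).hom.comp (X.presheaf.germ U (π.base ξ) hξU).hom) ∘ c)) =
          (maximalIdeal A).map φ := by
        rw [← hspanA, Ideal.map_span, ← Set.range_comp]
        exact congrArg Ideal.span (congrArg Set.range (funext fun l => (hφgerm (c l)).symm))
      rw [h1, hfam]
      exact congrArg Ideal.span (congrArg Set.range (funext fun i => hφgerm (c (j i))))
    obtain ⟨i, hi⟩ := exists_span_singleton_eq_of_span_range_eq₆ _ ht (hK.symm.trans hKt)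
    exact ⟨i, hgmem (j i) ξ hξU (hKt.trans hi.symm)⟩
  -- (5) specialisation from the chart points `ηpt i`; they all specialise to one another
  have hspec : ∀ (i : Fin (q + 1)) (w : Spec (.of (chartRing c (j i)))), g (j i) w ∈ S →
      g (j i) (ηpt i) ⤳ g (j i) w := by
    intro i w hw
    have hsp : ηpt i ⤳ w :=
      (PrimeSpectrum.le_iff_specializes (ηpt i) w).mp
        ((PrimeSpectrum.asIdeal_le_asIdeal (ηpt i) w).mp ((hkeyN i w).mp hw))
    exact hsp.map (g (j i)).continuous
  have hηrange : ∀ i i', g (j i') (ηpt i') ∈ Set.range (g (j i)) := by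
    intro i i'
    have hwU : π (g (j i') (ηpt i')) ∈ (U : X.Opens) := ((mem_projDirectrixFibre π x _).mp (hηS i')).1 ▸ hxU
    haveI := hgopen (j i')
    by_cases hii' : i = i'
    · subst hii'
      exact ⟨_, rfl⟩
    · -- `i = i'.succAbove m` for some `m`
      obtain ⟨m, hm⟩ := Fin.exists_succAbove_eq hii'
      subst hm
      exact hgmem (j (i'.succAbove m)) _ hwU (stalkIdeal_exceptional_eq_span_of_notMem π U
        (CommRingCat.ofHom (chartBase c (j i'))) c (j i') (fun l => chartGen c (j i') l) (g (j i')) (hgπ (j i'))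
        (fun k' => reesChartBase_apply_eq_mul_chartGen c (j i') k') hx hIc (ηpt i') hwU (j (i'.succAbove m))
        (hgenN i' m))
  have hηη : ∀ i i', g (j i) (ηpt i) ⤳ g (j i') (ηpt i') := by
    intro i i'
    obtain ⟨w, hw⟩ := hηrange i i'
    rw [← hw]
    exact hspec i w (hw ▸ hηS i')
  have hgen : ∀ i, ∀ ξ ∈ S, g (j i) (ηpt i) ⤳ ξ := by
    intro i ξ hξ
    obtain ⟨i', w, rfl⟩ := hcover ξ hξ
    exact (hηη i i').trans (hspec i' w hξ)
  have hGP : ∀ i, IsGenericPoint (g (j i) (ηpt i)) S := by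
    intro i
    refine isGenericPoint_iff_specializes.mpr fun ξ => ⟨fun h => ?_, fun h => hgen i ξ h⟩
    exact hSclosed.closure_subset_iff.mpr (Set.singleton_subset_iff.mpr (hηS i)) (specializes_iff_mem_closure.mp h)
  -- (6) `S` is irreducible (it is nonempty: `0 : Fin (q + 1)`), and the local computation on a chart through `y`
  haveI : IsProper π := hπ.isProper
  refine ⟨hSclosed, (hGP 0).isIrreducible, fun hC y hy => ?_⟩
  obtain ⟨i, w, rfl⟩ := hcover y hy
  haveI := hgopen (j i)
  obtain ⟨hreg, hdim0, hdimq⟩ :=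
    isRegularLocalRing_quotient_stalkIdeal_of_chart_mv (g (j i)) S hC (N i) (Ξ i) (hkeyN i) (hprimeN i) (hGP i) w hy
  exact ⟨hreg, hdim0, fun hcl => ⟨hdimq hcl, finite_residueFieldMap_of_isClosed π hcl⟩⟩

/-- **CJS 2020, p. 103 L16 / Def. 6.34 (i) for every `t = e_x(X) ≥ 1`, PROVED: `C_1 = ℙ(Dir_x(X)) ≅ ℙ^{t−1}_{k(x)}`** in the
tree's locus / local-ring rendering — discharges the named fact `ProjDir_projSpace` of `ProjDirProjectiveSpace.lean`
(`projDirectrixFibre_projSpace` with `t = q + 1`). [cite: CossartJannsenSaito2020, Def. 6.34 (i), p. 103 L16] -/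
theorem ProjDir_projSpace_holds : ProjDir_projSpace.{u} := by
  intro X X' _ π x hx t hπ hdir ht
  obtain ⟨q, rfl⟩ : ∃ q, t = q + 1 := ⟨t - 1, by omega⟩
  obtain ⟨h1, h2, h3⟩ := projDirectrixFibre_projSpace π x hx hπ hdir
  refine ⟨h1, h2, fun hC y hy => ?_⟩
  obtain ⟨hreg, hdim0, hcl⟩ := h3 hC y hy
  refine ⟨hreg, hdim0, fun hy' => ?_⟩
  obtain ⟨hdim, hfin⟩ := hcl hy'
  exact ⟨by rw [hdim, Nat.add_sub_cancel], hfin⟩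

end Literature.AlgebraicGeometry.CossartJannsenSaito2020

end
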